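import Summits.BirchSwinnertonDyer.BirchSwinnertonDyer.Theorems.SchneiderFreeControlAtoms
import HarnessLib
import HarnessLib.Audit.Tags

/-!
# Schneider-free additive X3 route — Manin-robust sockets, v2 (repair R1 of route `SchneiderFreeAdditiveX3`)

Cell bsd-schneider-ideate, seat P2 «around», gen 6 — repair R1, approved in principle by director-bsd 2026-08-25T23:23:34Z. Statements only (predicates + five elementary readings); nothing asserted.

## Why
The v1 sockets (`SchneiderFreeSockets.lean`) carry the hypothesis `¬ (p : ℤ) ∣ Dt.c` — the Manin-type
constant `c` of the parametrisation datum (`c • Λ_f ⊆ Λ_W`, `Λ_W` THE Néron lattice) prime to `p` — in every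
♯-input predicate, in `HeegnerTwistDataAt` (as an OBLIGATION) and in `JointLowerOfStepL`. At a good or
multiplicative prime this is automatic (Mazur 1978; Abbes–Ullmo 1996); at an ADDITIVE prime — the whole locus of
the route — it is Manin's conjecture at `p` for the optimal curve (`p² ∣ N`: only `v_p(c) ≤ v_p(deg φ)(+1)` is
known, Česnavičius–Neururer–Saha, arXiv:1911.09446 Thm. 1.2) together with the lattice-minimality
`Λ_{E_opt} ⊆ Λ_W` of the optimal curve in its `p`-power isogeny class (census kit j246813: 7 714/7 714 members
of the 7 339 X3 classes, 0 exceptions; at good/multiplicative `p` exceptions are common, e.g. `11a3` at `5`).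
But the constant CANCELS: the BDP `p`-adic `L`-function is intrinsic to the newform
(`log_{ω_E} y = c · log_{ω_f} P_K`), so "main conjecture ⊇ + BDP formula" gives T-B6-1 only with a slack
`2·v_p(c)` (`2·ord_p log_{ω_E} P ≤ ord_p f(0) + 2·v_p(c)`; JSW 2017, arXiv:1512.06894 p. 30, written there
with `p ∤ c_E`), while Gross–Zagier gives `#Ш_an(E)·#Ш_an(E^{d_K}) ∝ ([E(K):ℤP]/c)²` (the tree's
`gross_zagier` carries `Dt.c ^ 2` explicitly), so the JOINT lower bound holds with no condition on `c`.

## What (all predicates; the two `theorem`s are elementary readings)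
* `AdditiveIMCLowerBDPOnTreeLeAt … s P` — T-B6-1 with slack `s`: `2·ord_p log_ω P ≤ ord_p f(0) + 2s`;
  `additiveIMCLowerBDPOnTreeLeAt_of_onTreeAt` (v1 ⟹ every slack); `index_le_slack_of_additive_links`
  (kernel-checked bookkeeping: slack-`s` T-B6-1 ∧ T-B6-2′ ⟹ `2·ord_p[E(K):ℤP] ≤ ord_p #Ш(E/K)[p^∞] + ord_p ∏ c_w + 2s`).
* `AdditiveIMCLowerBDPInputManinAt W p`, `AdditiveControlInputManinAt W p`, `AdditiveStepLInputManinAt W p` —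
  the ♯-inputs WITHOUT `¬ p ∣ Dt.c`, the IMC/STEP-L conclusions at slack `v_p(Dt.c)`.
* `IndexLowerBoundLeAt W p K P s` — `X11b.IndexLowerBoundAt` with slack `2s` (`indexLowerBoundLeAt_of_indexLowerBoundAt`).
* `HeegnerTwistDataManinAt W p` — `HeegnerTwistDataAt` without the `¬ p ∣ Dt.c` conjunct
  (`heegnerTwistDataManinAt_of_heegnerTwistDataAt`).
* `JointLowerOfStepLManin` — the Gross–Zagier bookkeeping step with hypothesis
  `IndexLowerBoundLeAt W p K P (v_p Dt.c)` and no `¬ p ∣ Dt.c` (closed, conjecture-tagged;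
  `jointLowerOfStepL_of_manin`: it implies the v1 item).
The leaf `AdditiveX3RankOneLower` and the control predicates are unchanged (they never see `c`).
-/

noncomputable section

open scoped Classical

open WeierstrassCurve NumberField IsDedekindDomain Field Literature.NumberTheory.EllipticCurves
  Literature.NumberTheory.EllipticCurves.ModularForms
  Literature.NumberTheory.EllipticCurves.GreenbergSelmer
  Literature.NumberTheory.EllipticCurves.Rank1Residual
  Literature.NumberTheory.EllipticCurves.Rank1Residual.Typed
  Summit.BirchSwinnertonDyer.Rank1Residual
  Summit.BirchSwinnertonDyer.Rank1Residual.X11b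
  Summit.BirchSwinnertonDyer.Rank1Residual.X11b.AcSelmer
  Summit.BirchSwinnertonDyer.Rank1Residual.X11b.Halves

set_option linter.dupNamespace false

namespace Summit.BirchSwinnertonDyer.BirchSwinnertonDyer.Theorems.SchneiderFree

/-! ### T-B6-1 with a Manin slack, and the bookkeeping -/

/-- **T-B6-1 with slack `s` (pointwise).** For a generator `f` of the characteristic ideal of the
Greenberg/BDP module, `2·ord_p log_{ω_E} P ≤ ord_p f(0) + 2s`. With `s = v_p(c_φ)` this is exactly what
"anticyclotomic main conjecture ⊇ + BDP formula" gives for a parametrisation `φ` with constant `c_φ`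
(`log_{ω_E} φ(P_K) = c_φ · log_{ω_f} P_K`, the BDP value being intrinsic to `f`). A predicate; nothing
asserted. [cite: JetchevSkinnerWan2017, §7.4.1 (arXiv p. 30)] [cite: LiuZhangZhang2018, Thm. 1.8] -/
@[conjecture]
def AdditiveIMCLowerBDPOnTreeLeAt (p : ℕ) [Fact p.Prime] {K : Type} [Field K] [NumberField K]
    {W : WeierstrassCurve ℚ} [W.IsElliptic] [W.IsGloballyMinimal] (κ : ZpExtension K p)
    (𝔭 : HeightOneSpectrum (𝓞 K)) (γ : Field.absoluteGaloisGroup K) [Fact (κ.IsTopGenerator γ)]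
    (ι : K →+* ℚ_[p]) (s : ℕ) (P : (W.baseChange K).toAffine.Point) : Prop :=
  ∃ n : ℕ, XAc.HasCharValuationAt (W.baseChange K) p κ 𝔭 ∅ γ n ∧
    2 * X11b.padicLogOrd W p ι P ≤ (n : ℤ) + 2 * (s : ℤ)

section Links

variable {p : ℕ} [Fact p.Prime] {K : Type} [Field K] [NumberField K]
  {W : WeierstrassCurve ℚ} [W.IsElliptic] [W.IsGloballyMinimal] {κ : ZpExtension K p}
  {𝔭 : HeightOneSpectrum (𝓞 K)} {γ : Field.absoluteGaloisGroup K} [Fact (κ.IsTopGenerator γ)]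
  {ι : K →+* ℚ_[p]}

/-- v1's T-B6-1 (no slack) gives T-B6-1 with every slack. [folklore] -/
theorem additiveIMCLowerBDPOnTreeLeAt_of_onTreeAt {P : (W.baseChange K).toAffine.Point}
    (h : AdditiveIMCLowerBDPOnTreeAt p κ 𝔭 γ ι P) (s : ℕ) :
    AdditiveIMCLowerBDPOnTreeLeAt p κ 𝔭 γ ι s P := by
  obtain ⟨n, hn, hle⟩ := h
  refine ⟨n, hn, ?_⟩
  have hs : (0 : ℤ) ≤ 2 * (s : ℤ) := by positivity
  omega

/-- **Bookkeeping with a Manin slack (kernel-checked):** slack-`s` T-B6-1 ∧ T-B6-2′ at one frame give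
`2·ord_p[E(K):ℤP] ≤ ord_p #Ш(E/K)[p^∞] + ord_p ∏_{w∣N⁺} c_w(E/K) + 2s` (JSW17 (eq:shalowerK-1) with the
Manin slack made explicit). [folklore] -/
theorem index_le_slack_of_additive_links {P : (W.baseChange K).toAffine.Point} {s : ℕ}
    (h1 : AdditiveIMCLowerBDPOnTreeLeAt p κ 𝔭 γ ι s P) (h2 : AdditiveControlOnTreeAt p κ 𝔭 γ ι P) :
    2 * (padicValNat p (AddSubgroup.zmultiples P).index : ℤ) ≤
      (padicValNat p (Nat.card (AddCommGroup.primaryComponent (W.baseChange K).sha p)) : ℤ) +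
        padicValNat p (X11b.tamagawaProductSplit W K) + 2 * (s : ℤ) := by
  obtain ⟨n, hn, hle⟩ := h1
  obtain ⟨n', hn', heq⟩ := h2
  obtain rfl : n = n' := hn.unique hn'
  omega

end Links

/-! ### The ♯-inputs without `¬ p ∣ Dt.c` -/

/-- **`X11b.IndexLowerBoundAt` with slack `2s`:** `2·ord_p[E(K):ℤP] ≤ ord_p #Ш(E/K) + 2·ord_p ∏_ℓ c_ℓ(E) + 2s`.
A predicate; nothing asserted. [cite: JetchevSkinnerWan2017, §7.4.1 (eq:shalowerK-1)] -/
def IndexLowerBoundLeAt (W : WeierstrassCurve ℚ) (p : ℕ) (K : Type) [Field K] [NumberField K]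
    (P : (W.baseChange K).toAffine.Point) (s : ℕ) : Prop :=
  2 * padicValNat p (AddSubgroup.zmultiples P).index ≤
    padicValNat p (W.baseChange K).shaOrder + 2 * padicValNat p W.tamagawaProduct + 2 * s

/-- Slack `0` ⟸ v1, and monotonicity in the slack. [folklore] -/
theorem indexLowerBoundLeAt_of_indexLowerBoundAt {W : WeierstrassCurve ℚ} {p : ℕ} {K : Type} [Field K]
    [NumberField K] {P : (W.baseChange K).toAffine.Point} (h : X11b.IndexLowerBoundAt W p K P) (s : ℕ) :
    IndexLowerBoundLeAt W p K P s := by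
  unfold IndexLowerBoundLeAt
  unfold X11b.IndexLowerBoundAt at h
  omega

/-- **STEP L♯ without `p ∤ c` (the route's target, Manin-robust form):** on the N10 locus with `r_an = 1`,
for every Heegner datum (ANY parametrisation datum `Dt`), `IndexLowerBoundLeAt W p K P (v_p Dt.c)`.
A predicate; nothing asserted. [cite: JetchevSkinnerWan2017, §7.4.1] -/
@[conjecture]
def AdditiveStepLInputManinAt (W : WeierstrassCurve ℚ) [W.IsElliptic] [W.IsGloballyMinimal] (p : ℕ)
    [Fact p.Prime] : Prop :=
  ∀ (N : ℕ) [NeZero N] (K : Type) [Field K] [NumberField K]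
    (Dt : ModularParametrizationData W N) (H : HeegnerDatum N (NumberField.discr K)) (ι : K →+* ℂ)
    (P : (W.baseChange K).toAffine.Point),
    W.analyticRank = 1 → Additive.N10.Locus W p → W.conductorNorm ℤ = N → IsImaginaryQuadratic K →
    Odd (NumberField.discr K) → ¬ p ∣ Units.torsionOrder K → SatisfiesHeegnerHypothesis N K →
    (W.quadraticTwist (NumberField.discr K : ℚ)).entireLFunction 1 ≠ 0 →
    WeierstrassCurve.Affine.Point.map ι.toRatAlgHom P = heegnerPointComplex Dt H →
    ¬ IsOfFinAddOrder P → IndexLowerBoundLeAt W p K P (padicValNat p Dt.c.natAbs)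

/-- **T-B6-1♯ without `p ∤ c`:** T-B6-1 at slack `v_p(Dt.c)` over the B6 data and every anticyclotomic
frame. A predicate; nothing asserted. [cite: LiuZhangZhang2018, Thm. 1.8] [cite: JetchevSkinnerWan2017, §7.4.1] -/
@[conjecture]
def AdditiveIMCLowerBDPInputManinAt (W : WeierstrassCurve ℚ) [W.IsElliptic] [W.IsGloballyMinimal] (p : ℕ)
    [Fact p.Prime] : Prop :=
  ∀ (N : ℕ) [NeZero N] (K : Type) [Field K] [NumberField K]
    (Dt : ModularParametrizationData W N) (H : HeegnerDatum N (NumberField.discr K)) (ι : K →+* ℂ)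
    (P : (W.baseChange K).toAffine.Point),
    W.analyticRank = 1 → Additive.N10.Locus W p → W.conductorNorm ℤ = N → IsImaginaryQuadratic K →
    Odd (NumberField.discr K) → ¬ p ∣ Units.torsionOrder K → SatisfiesHeegnerHypothesis N K →
    (W.quadraticTwist (NumberField.discr K : ℚ)).entireLFunction 1 ≠ 0 →
    WeierstrassCurve.Affine.Point.map ι.toRatAlgHom P = heegnerPointComplex Dt H →
    ¬ IsOfFinAddOrder P →
    ∀ (κ : ZpExtension K p), κ.IsAnticyclotomic →
      ∀ (γ : Field.absoluteGaloisGroup K) [Fact (κ.IsTopGenerator γ)]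
        (𝔭 : HeightOneSpectrum (𝓞 K)) (h𝔭 : ((p : ℕ) : 𝓞 K) ∈ 𝔭.asIdeal)
        (he : 𝔭.asIdeal.ramificationIdx (𝓞 ℚ) = 1) (hf : 𝔭.asIdeal.inertiaDeg (𝓞 ℚ) = 1),
        AdditiveIMCLowerBDPOnTreeLeAt p κ 𝔭 γ (embAt K p 𝔭 h𝔭 he hf) (padicValNat p Dt.c.natAbs) P

/-- **T-B6-2′♯ without `p ∤ c`** (control never sees the parametrisation constant; the hypothesis is
simply dropped). A predicate; nothing asserted. [cite: JetchevSkinnerWan2017, Thm. 3.3.1] -/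
@[conjecture]
def AdditiveControlInputManinAt (W : WeierstrassCurve ℚ) [W.IsElliptic] [W.IsGloballyMinimal] (p : ℕ)
    [Fact p.Prime] : Prop :=
  ∀ (N : ℕ) [NeZero N] (K : Type) [Field K] [NumberField K]
    (Dt : ModularParametrizationData W N) (H : HeegnerDatum N (NumberField.discr K)) (ι : K →+* ℂ)
    (P : (W.baseChange K).toAffine.Point),
    W.analyticRank = 1 → Additive.N10.Locus W p → W.conductorNorm ℤ = N → IsImaginaryQuadratic K →
    Odd (NumberField.discr K) → ¬ p ∣ Units.torsionOrder K → SatisfiesHeegnerHypothesis N K →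
    (W.quadraticTwist (NumberField.discr K : ℚ)).entireLFunction 1 ≠ 0 →
    WeierstrassCurve.Affine.Point.map ι.toRatAlgHom P = heegnerPointComplex Dt H →
    ¬ IsOfFinAddOrder P →
    ∀ (κ : ZpExtension K p), κ.IsAnticyclotomic →
      ∀ (γ : Field.absoluteGaloisGroup K) [Fact (κ.IsTopGenerator γ)]
        (𝔭 : HeightOneSpectrum (𝓞 K)) (h𝔭 : ((p : ℕ) : 𝓞 K) ∈ 𝔭.asIdeal)
        (he : 𝔭.asIdeal.ramificationIdx (𝓞 ℚ) = 1) (hf : 𝔭.asIdeal.inertiaDeg (𝓞 ℚ) = 1),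
        AdditiveControlOnTreeAt p κ 𝔭 γ (embAt K p 𝔭 h𝔭 he hf) P

/-- The Manin-robust control input gives v1's (which merely has one more, unused, hypothesis). [folklore] -/
theorem additiveControlInputAt_of_manin {W : WeierstrassCurve ℚ} [W.IsElliptic] [W.IsGloballyMinimal]
    {p : ℕ} [Fact p.Prime] (h : AdditiveControlInputManinAt W p) : AdditiveControlInputAt W p := by
  intro N _ K _ _ Dt H ι P hr hL hN hK hodd hw hHH hLd hP _hc hnt κ hκ γ _ 𝔭 h𝔭 he hf
  exact h N K Dt H ι P hr hL hN hK hodd hw hHH hLd hP hnt κ hκ γ 𝔭 h𝔭 he hf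

/-! ### Heegner/twist data and the Gross–Zagier step without `¬ p ∣ Dt.c` -/

/-- **The Heegner/twist data of the route, Manin-robust** (`HeegnerTwistDataAt` without the conjunct
`¬ (p : ℤ) ∣ Dt.c`): a Heegner field `K` for `N_E` with odd `d_K`, `p ∤ #𝓞_K^×`, `L(E^{d_K},1) ≠ 0`, ANY
parametrisation datum, its traced Heegner point (non-torsion), and a globally minimal model of the twist on
the same cells with `r_an = 0`. A predicate; nothing asserted. [cite: GrossZagier1986, Thm. I.(6.3)] -/
def HeegnerTwistDataManinAt (W : WeierstrassCurve ℚ) [W.IsElliptic] [W.IsGloballyMinimal] (p : ℕ)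
    [Fact p.Prime] : Prop :=
  ∃ (N : ℕ) (_ : NeZero N) (K : Type) (_ : Field K) (_ : NumberField K)
    (Dt : ModularParametrizationData W N) (H : HeegnerDatum N (NumberField.discr K)) (ι : K →+* ℂ)
    (P : (W.baseChange K).toAffine.Point) (Wd : WeierstrassCurve ℚ) (_ : Wd.IsElliptic)
    (_ : Wd.IsGloballyMinimal),
    W.conductorNorm ℤ = N ∧ IsImaginaryQuadratic K ∧ Odd (NumberField.discr K) ∧
    ¬ p ∣ Units.torsionOrder K ∧ SatisfiesHeegnerHypothesis N K ∧
    (W.quadraticTwist (NumberField.discr K : ℚ)).entireLFunction 1 ≠ 0 ∧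
    WeierstrassCurve.Affine.Point.map ι.toRatAlgHom P = heegnerPointComplex Dt H ∧
    ¬ IsOfFinAddOrder P ∧
    (∃ C : VariableChange ℚ, C • W.quadraticTwist (NumberField.discr K : ℚ) = Wd) ∧
    Wd.analyticRank = 0 ∧ ClassX3 Wd p ∧ Additive.SubSemistableTwist Wd p

/-- v1's data (with `p ∤ c`) are Manin-robust data. [folklore] -/
theorem heegnerTwistDataManinAt_of_heegnerTwistDataAt {W : WeierstrassCurve ℚ} [W.IsElliptic]
    [W.IsGloballyMinimal] {p : ℕ} [Fact p.Prime] (h : HeegnerTwistDataAt W p) :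
    HeegnerTwistDataManinAt W p := by
  obtain ⟨N, hN, K, hF, hNF, Dt, H, ι, P, Wd, hWe, hWm, h1, h2, h3, h4, h5, h6, h7, _h8, h9, h10, h11, h12, h13⟩ := h
  exact ⟨N, hN, K, hF, hNF, Dt, H, ι, P, Wd, hWe, hWm, h1, h2, h3, h4, h5, h6, h7, h9, h10, h11, h12, h13⟩

/-- **Gross–Zagier bookkeeping, Manin-robust (closed, conjecture-tagged route leaf).** For the Heegner/twist
data and ANY parametrisation datum `Dt`: STEP L at slack `v_p(Dt.c)`
(`2·ord_p[E(K):ℤP] ≤ ord_p #Ш(E/K) + 2·ord_p ∏ c_ℓ(E) + 2·v_p(c)`) ⟹ the JOINT lower half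
`ord_p #Ш(E)_an + ord_p #Ш(E^{d_K})_an ≤ ord_p #Ш(E) + ord_p #Ш(E^{d_K})`. Content: Gross–Zagier I.(6.3) with
the constant kept (`#Ш_an(E)·#Ш_an(E^{d_K}) ∏c_ℓ(E) ∏c_ℓ(E^{d_K}) ≐ ([E(K):ℤP]/c)²`, the tree's `gross_zagier`
carries `Dt.c ^ 2`), `Ш(E/K)[p^∞] = Ш(E)[p^∞] ⊕ Ш(E^{d_K})[p^∞]` at odd `p` (Kolyvagin finiteness),
(eq:tamK) for odd `d_K`; the `2·v_p(c)` terms cancel. Nothing asserted.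
[cite: GrossZagier1986, Thm. I.(6.3) and V.(2.2)] [cite: JetchevSkinnerWan2017, §7.4.1 (arXiv p. 30)] -/
@[conjecture]
def JointLowerOfStepLManin : Prop :=
  ∀ (W : WeierstrassCurve ℚ) [W.IsElliptic] [W.IsGloballyMinimal] (p : ℕ) [Fact p.Prime]
    (N : ℕ) [NeZero N] (K : Type) [Field K] [NumberField K]
    (Dt : ModularParametrizationData W N) (H : HeegnerDatum N (NumberField.discr K)) (ι : K →+* ℂ)
    (P : (W.baseChange K).toAffine.Point) (Wd : WeierstrassCurve ℚ) [Wd.IsElliptic]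
    [Wd.IsGloballyMinimal],
    W.analyticRank = 1 → W.conductorNorm ℤ = N → IsImaginaryQuadratic K →
    Odd (NumberField.discr K) → ¬ p ∣ Units.torsionOrder K → SatisfiesHeegnerHypothesis N K →
    (W.quadraticTwist (NumberField.discr K : ℚ)).entireLFunction 1 ≠ 0 →
    WeierstrassCurve.Affine.Point.map ι.toRatAlgHom P = heegnerPointComplex Dt H →
    ¬ IsOfFinAddOrder P →
    (∃ C : VariableChange ℚ, C • W.quadraticTwist (NumberField.discr K : ℚ) = Wd) →
    Wd.analyticRank = 0 → p ≠ 2 → IndexLowerBoundLeAt W p K P (padicValNat p Dt.c.natAbs) →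
    JointLowerBoundAt W Wd p

/-- The Manin-robust leaf implies v1's `JointLowerOfStepL` (under `p ∤ c` the slack vanishes). [folklore] -/
theorem jointLowerOfStepL_of_manin (h : JointLowerOfStepLManin) : JointLowerOfStepL := by
  intro W _ _ p _ N _ K _ _ Dt H ι P Wd _ _ hr hN hK hodd hw hHH hLd hP hc hnt hC hr0 hp2 hI
  have hp : p.Prime := Fact.out
  have hs : padicValNat p Dt.c.natAbs = 0 := by
    rw [padicValNat.eq_zero_iff]
    right; right
    intro hdvd
    exact hc (Int.ofNat_dvd_left.mpr hdvd)
  refine h W p N K Dt H ι P Wd hr hN hK hodd hw hHH hLd hP hnt hC hr0 hp2 ?_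
  have hI' := indexLowerBoundLeAt_of_indexLowerBoundAt hI 0
  simpa [hs] using hI'

end Summit.BirchSwinnertonDyer.BirchSwinnertonDyer.Theorems.SchneiderFree

end
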